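import Summits.ValiantsHypothesis.ValiantsHypothesis.Theorems.SymPencilSdcPerThreeTen
import Literature.Computability.AlgebraicComplexity.Quarez12SymmetricRepresentations
import Literature.Computability.AlgebraicComplexity.StandardFamiliesProofs

/-!
# Route `SymPencil` — calibration window for the symmetric determinantal complexity of `per₃`:
# `13 ≤ sdc(per₃) ≤ 20`

CALIBRATION WINDOW — replaces the route text's «an upper bound of a few dozen follows from GKKP Thm 4» by
Quarez's `20`; decides nothing; not in the `closes`-cone (support of the crux `SdcPerBeyondN`,
stmt-ValiantsHypothesis-5676, through its `n = 3` instance; nothing is proved or refuted about the crux, which quantifies over all `n ≥ 3`; not a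
`closes`-cone statement). The tree holds the LOWER bound `13 ≤ m` for every symmetric affine
determinantal representation of `per₃` (`SymPencilSdcPerThreeTen.thirteen_le_of_isSymm_isAffineDetRepr_perPoly_three`,
the symmetric Alper–Bogart–Velasco inequality) and, since val-lit-t16's `Quarez12SymmetricRepresentations`,
Quarez's universal UPPER bound `HasSymmDetRepr p (2·C(|σ| + ⌊d/2⌋, ⌊d/2⌋))` for any `p` of total
degree `≤ d`. This file records the resulting window in the tree's `symmDeterminantalComplexity`
vocabulary:

* `sdc_perPoly_le_quarez`: `sdc(per_n) ≤ 2·C(n² + ⌊n/2⌋, ⌊n/2⌋)` over any commutative ring with `2`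
  invertible (`per_n` has total degree `n`);
* `sdc_perPoly_three_le_twenty`: `sdc(per₃) ≤ 20`;
* `sdc_perPoly_three_window`: `13 ≤ sdc(per₃) ≤ 20` over any field with `2 ≠ 0` (so over `ℂ`).

The exact value of `sdc(per₃)` in `[13, 20]` is not known to the tree (nor, to our reading, in print).
HONEST FRAMING: finite calibration of one crux instance; nothing here bears on `VP ≠ VNP`.

## References

* [Quarez2012] R. Quarez, *Symmetric determinantal representation of polynomials*, LAA 436 (2012),
  Thm. 4.1 (1) (tree: `hasSymmDetRepr_of_totalDegree_le'`, val-lit-t16).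
* [AlperBogartVelasco2017] J. Alper, T. Bogart, M. Velasco, Found. Comput. Math. 17 (2017), proof of
  Thm. 1.2 (symmetric form in the tree: `exists_subspace_of_isSymm_isAffineDetRepr_perPoly`).
-/

noncomputable section

-- `Summit.<Summit>.<Problem>` repeats `ValiantsHypothesis` by the tree's layout convention (D-0017).
set_option linter.dupNamespace false

namespace Summit.ValiantsHypothesis.ValiantsHypothesis.Theorems.SymPencilSdcPerThreeWindow

open MvPolynomial Literature.Computability.AlgebraicComplexity
open Summit.ValiantsHypothesis.ValiantsHypothesis.Theorems.SymPencilSdcPerThreeTen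
open Literature.Computability.AlgebraicComplexity.Quarez2012

/-- **Quarez's bound for the permanent**: over a commutative ring in which `2` is invertible,
`per_n` (total degree `n`) has a symmetric affine determinantal representation of size
`2·C(n² + ⌊n/2⌋, ⌊n/2⌋)`. [cite: Quarez2012, Thm. 4.1 (1)] -/
theorem hasSymmDetRepr_perPoly_quarez (R : Type*) [CommRing R] [Invertible (2 : R)] [Nontrivial R]
    (n : ℕ) : HasSymmDetRepr (perPoly (Fin n) R) (2 * (n * n + n / 2).choose (n / 2)) := by
  have hdeg : (perPoly (Fin n) R).totalDegree ≤ n := by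
    rw [totalDegree_perPoly_holds (n := Fin n) (k := R), Fintype.card_fin]
  have h := hasSymmDetRepr_of_totalDegree_le' (perPoly (Fin n) R) hdeg
  simpa [Fintype.card_prod, Fintype.card_fin] using h

/-- `sdc(per_n) ≤ 2·C(n² + ⌊n/2⌋, ⌊n/2⌋)` (fields with `2 ≠ 0`). [cite: Quarez2012, Thm. 4.1 (1)] -/
theorem sdc_perPoly_le_quarez (K : Type*) [Field K] (h2 : (2 : K) ≠ 0) (n : ℕ) :
    symmDeterminantalComplexity (perPoly (Fin n) K) ≤ 2 * (n * n + n / 2).choose (n / 2) := by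
  letI : Invertible (2 : K) := invertibleOfNonzero h2
  exact symmDeterminantalComplexity_le (hasSymmDetRepr_perPoly_quarez K n)

/-- **`sdc(per₃) ≤ 20`** (`2·C(9 + 1, 1) = 20`). [cite: Quarez2012, Thm. 4.1 (1)] -/
theorem sdc_perPoly_three_le_twenty (K : Type*) [Field K] (h2 : (2 : K) ≠ 0) :
    symmDeterminantalComplexity (perPoly (Fin 3) K) ≤ 20 := by
  simpa using sdc_perPoly_le_quarez K h2 3

/-- **The window `13 ≤ sdc(per₃) ≤ 20`** over any field with `2 ≠ 0`: the lower bound is the tree's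
symmetric Alper–Bogart–Velasco bound applied to an optimal symmetric representation (which exists
by Quarez), the upper bound is Quarez's. [folklore] -/
theorem sdc_perPoly_three_window (K : Type*) [Field K] (h2 : (2 : K) ≠ 0) :
    13 ≤ symmDeterminantalComplexity (perPoly (Fin 3) K) ∧
      symmDeterminantalComplexity (perPoly (Fin 3) K) ≤ 20 := by
  letI : Invertible (2 : K) := invertibleOfNonzero h2
  refine ⟨?_, sdc_perPoly_three_le_twenty K h2⟩
  obtain ⟨A, hS, hA⟩ := hasSymmDetRepr_symmDeterminantalComplexity ⟨_, hasSymmDetRepr_perPoly_quarez K 3⟩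
  exact thirteen_le_of_isSymm_isAffineDetRepr_perPoly_three K h2 hS hA

/-- The complex instance. [folklore] -/
theorem sdc_perPoly_three_window_complex :
    13 ≤ symmDeterminantalComplexity (perPoly (Fin 3) ℂ) ∧
      symmDeterminantalComplexity (perPoly (Fin 3) ℂ) ≤ 20 :=
  sdc_perPoly_three_window ℂ two_ne_zero

end Summit.ValiantsHypothesis.ValiantsHypothesis.Theorems.SymPencilSdcPerThreeWindow

end
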